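import Mathlib
import Literature.Analysis.FluidPDE.SereginSverakPressureLocalTypeI
import Literature.Analysis.FluidPDE.SereginSverakPressure
import Literature.Analysis.FluidPDE.LocalTypeIMorreyProofs
import Literature.Analysis.FluidPDE.NSCriticalClosureBesovKatoClass
import Literature.Analysis.FluidPDE.KatoMaximalTime
import Summits.NavierStokesRegularity.NavierStokesRegularity.Theorems.StretchingWellBindingTypeIBridgeTools
import Summits.NavierStokesRegularity.NavierStokesRegularity.Theorems.CertifiedBlowupCertifiedBlowupAxisymBlowupKatoLifespan
import Summits.NavierStokesRegularity.NavierStokesRegularity.Theses.MarginalTypeI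
import HarnessLib

/-!
# `MarginalTypeI.LocalTypeIExtraction` — Type-I extraction (item stmt-NavierStokesRegularity-11301)

**Statement.** `ν > 0`; `u₀` smooth, divergence free, rapidly decaying, WITHOUT a global Kato
solution at `ν`; assume every Kato solution `u` of `u₀` on `[0, T)` has, at every `x₀`, a radius
`r₀ > 0` with `sup {C(Q(z, r)) : Q(z, r) ⊆ Q((T, x₀), r₀)} < ∞` (scaled cubic quantity
`C = cknC`). Then some suitable weak solution of the unit-viscosity system has a local Type-I
singular point in the sense of Albritton–Barker 2019 (`IsLocalTypeISingularPoint r₀ z v q`).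

PROOF (known-result chain, every input proved in the tree).
1. *Maximal development.* `¬ HasGlobalKatoSolution` is `T_max(u₀) < ∞`
   (`katoMaximalTime_eq_top_iff`, `kato_unique_holds`), so the datum launches a MAXIMAL classical
   solution `(u, p)` on `[0, T)`, `T = T_max`, Leray–Hopf from `u₀`
   (`CertifiedBlowupAxisymBlowup.CompactAmplification.exists_isMaximalSmoothSolution_of_katoMaximalTime_lt_top`);
   it is a Kato solution on `[0, T)` (`isKatoSolutionOn_of_classical`), so the hypothesis applies to it.
2. *A bad point.* A maximal classical Leray–Hopf solution is not backward bounded at some `(T, x₀)`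
   (`TypeIBridge.exists_not_isBackwardBoundedAt`).
3. *The zoom* (`exists_zoom_typeIBound_lt_top_of_cknC`, the tree's block of
   `SereginSverak2002.exists_zoom_typeIBound_lt_top` with the scaled ENERGY `A` replaced by the
   scaled CUBIC quantity `C`). About `(T, x₀)` the viscosity-normalising zoom `v = α u ∘ Φ`,
   `π = α² q ∘ Φ` (`Φ(s, y) = (T + βs, x₀ + Ry)`, `α = R/ν`, `β = R²/ν`, `q` Tao's gauge of the
   pressure) is a suitable weak solution in `Q(0, 1)`; a parabolic sub-ball `Q(z', r) ⊆ Q(0, 1)`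
   is the preimage of the ANISOTROPIC physical cylinder of radius `Rr` and duration `R²r²/ν`,
   which lies in the standard cylinder of radius `κRr`, `κ = max(1, 1/ν)`, about the same top
   point; for `R ≤ r₀/(2κ)` that cylinder is a sub-ball of `Q((T, x₀), r₀)`, so
   `C(Q(z', r); v) ≤ (κ²/ν²)·M` uniformly — `sup C < ∞` on the sub-balls of `Q(0, 1)`.
4. *Albritton–Barker Lemma 2.6*, `C`-case (`albrittonBarker2019_lemma_2_6_holds`, Seregin 2006
   Lemma 2.1 (b)): `𝐈(Q(0, 1/2)) < ∞`; and the bad point makes the origin a backward singular point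
   of `v` (`SereginSverak2002.isBackwardBoundedAt_of_zoom`).

HONEST FRAMING: a bookkeeping bridge between two formulations of a HYPOTHETICAL Type-I singularity;
no such singularity is asserted to exist. Nothing here bears on the regularity problem itself. -/

noncomputable section

set_option linter.dupNamespace false

namespace Summit.NavierStokesRegularity.NavierStokesRegularity.Theorems

open MeasureTheory Set Filter Topology Metric Function Literature.Analysis.FluidPDE
open scoped NNReal ENNReal

namespace LocalTypeIExtraction

variable {ν T : ℝ} {u : ℝ → (EuclideanSpace ℝ (Fin 3)) → (EuclideanSpace ℝ (Fin 3))} {p : ℝ → (EuclideanSpace ℝ (Fin 3)) → ℝ}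


/-! ### The scaled cubic quantity under the viscosity-normalising zoom -/

/-- **Transport of the scaled cubic quantity under the parabolic zoom.** Let `v = α u ∘ Φ`,
`Φ(s, y) = (T + βs, x₀ + Ry)`, with `0 < β ≤ κ²R²`, `κ ≥ 1`, `κR ≤ r₀/2`. A parabolic sub-ball
`Q(z', r) ⊆ Q(0, 1)` is the preimage under `Φ` of the anisotropic cylinder of duration `βr²` and
radius `Rr` below the physical point `(T + βz'.1, x₀ + Rz'.2)`, which lies in the standard
parabolic ball of radius `κRr` about that point, itself a sub-ball of `Q((T, x₀), r₀)`; so a bound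
`C ≤ M` on the sub-balls of `Q((T, x₀), r₀)` gives `C(Q(z', r); v) ≤ α³ (βR³)⁻¹ (κR)² M` (the
factor `r²` cancels). [folklore] -/
theorem cknC_zoom_le {T R α β κ r₀ : ℝ} (x₀ : EuclideanSpace ℝ (Fin 3)) (hRpos : 0 < R)
    (hβpos : 0 < β) (hκ1 : 1 ≤ κ) (hβle : β ≤ κ ^ 2 * R ^ 2) (hRκ : κ * R ≤ r₀ / 2)
    (u : ℝ → (EuclideanSpace ℝ (Fin 3)) → (EuclideanSpace ℝ (Fin 3))) {M : ℝ≥0}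
    (hC : ∀ (r : ℝ) (z : ℝ × (EuclideanSpace ℝ (Fin 3))), 0 < r →
      parabolicCylinder r z ⊆ parabolicCylinder r₀ ((T, x₀) : ℝ × (EuclideanSpace ℝ (Fin 3))) →
        cknC r z u ≤ M)
    {r : ℝ} {z' : ℝ × (EuclideanSpace ℝ (Fin 3))} (hr : 0 < r)
    (hz' : parabolicCylinder r z' ⊆ parabolicCylinder 1 (0 : ℝ × (EuclideanSpace ℝ (Fin 3)))) :
    cknC r z' (α • stPull β R T x₀ u) ≤
      ‖α‖ₑ ^ 3 * ENNReal.ofReal (β * R ^ 3)⁻¹ * (ENNReal.ofReal ((κ * R) ^ 2) * (M : ℝ≥0∞)) := by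
  have hκpos : 0 < κ := lt_of_lt_of_le one_pos hκ1
  obtain ⟨-, -, ht1, ht2, hdist⟩ := parabolicCylinder_subset_data hr hz'
  simp only [Prod.fst_zero, one_pow, zero_sub, Prod.snd_zero] at ht1 ht2 hdist
  have hr1 : r ≤ 1 := by nlinarith
  have hz'n : ‖z'.2‖ < 1 := by rwa [dist_zero_right] at hdist
  have hz'1 : -1 ≤ z'.1 := by linarith [sq_nonneg r]
  -- the physical (anisotropic) cylinder `S` and the enlarged standard cylinder `Q'`
  set t' : ℝ := T + β * z'.1 with ht'
  set x' : EuclideanSpace ℝ (Fin 3) := x₀ + R • z'.2 with hx'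
  set ρ : ℝ := R * r with hρ
  set ρ' : ℝ := κ * ρ with hρ'
  have hρpos : 0 < ρ := by positivity
  have hρ'pos : 0 < ρ' := by positivity
  have hρR : ρ ≤ R := by rw [hρ]; exact mul_le_of_le_one_right hRpos.le hr1
  have hρρ' : ρ ≤ ρ' := by rw [hρ']; exact le_mul_of_one_le_left hρpos.le hκ1
  have hρ'le : ρ' ≤ κ * R := by rw [hρ']; exact mul_le_mul_of_nonneg_left hρR hκpos.le
  have hRκR : R ≤ κ * R := le_mul_of_one_le_left hRpos.le hκ1
  set S : Set (ℝ × (EuclideanSpace ℝ (Fin 3))) := Ioo (T + β * (z'.1 - r ^ 2)) t' ×ˢ ball x' ρ with hS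
  -- `Q(z', r)` is the preimage of `S`
  have hpre : parabolicCylinder r z' = stAffine β R T x₀ ⁻¹' S := by
    rw [hS, stAffine_preimage_cylinder hβpos hRpos T x₀ x' (T + β * (z'.1 - r ^ 2)) t' ρ,
      parabolicCylinder]
    have e1 : (T + β * (z'.1 - r ^ 2) - T) / β = z'.1 - r ^ 2 := by
      field_simp; ring
    have e2 : (t' - T) / β = z'.1 := by rw [ht']; field_simp; ring
    have e3 : R⁻¹ • (x' - x₀) = z'.2 := by
      rw [hx', add_sub_cancel_left, smul_smul, inv_mul_cancel₀ hRpos.ne', one_smul]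
    have e4 : ρ / R = r := by rw [hρ, mul_div_cancel_left₀ r hRpos.ne']
    rw [e1, e2, e3, e4]
  -- `S ⊆ Q'((t', x'), ρ')`: duration `β r² ≤ ρ'²`, radius `ρ ≤ ρ'`
  have hρ'sq : β * r ^ 2 ≤ ρ' ^ 2 := by
    have h2 : ρ' ^ 2 = κ ^ 2 * R ^ 2 * r ^ 2 := by rw [hρ', hρ]; ring
    rw [h2]
    exact mul_le_mul_of_nonneg_right hβle (sq_nonneg _)
  have hSsub : S ⊆ parabolicCylinder ρ' ((t', x') : ℝ × (EuclideanSpace ℝ (Fin 3))) := by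
    rw [hS, parabolicCylinder]
    refine prod_mono (Ioo_subset_Ioo ?_ le_rfl) (ball_subset_ball hρρ')
    dsimp only
    have e : β * (z'.1 - r ^ 2) = β * z'.1 - β * r ^ 2 := by ring
    rw [e, ht']
    linarith
  -- `Q'((t', x'), ρ') ⊆ Q((T, x₀), r₀)`
  have hQ'sub : parabolicCylinder ρ' ((t', x') : ℝ × (EuclideanSpace ℝ (Fin 3))) ⊆
      parabolicCylinder r₀ ((T, x₀) : ℝ × (EuclideanSpace ℝ (Fin 3))) := by
    rw [parabolicCylinder, parabolicCylinder]
    have h3 : ρ' ^ 2 ≤ (κ * R) ^ 2 := pow_le_pow_left₀ hρ'pos.le hρ'le 2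
    have h4 : (κ * R) ^ 2 ≤ (r₀ / 2) ^ 2 := pow_le_pow_left₀ (by positivity) hRκ 2
    have h5 : (κ * R) ^ 2 = κ ^ 2 * R ^ 2 := by ring
    have h6 : (r₀ / 2) ^ 2 = r₀ ^ 2 / 4 := by ring
    have h7 : 0 ≤ β * (z'.1 + 1) := mul_nonneg hβpos.le (by linarith)
    have h8 : β * z'.1 ≤ 0 := mul_nonpos_iff.2 (Or.inl ⟨hβpos.le, ht2⟩)
    refine prod_mono (Ioo_subset_Ioo ?_ ?_) ?_
    · dsimp only
      rw [ht']
      nlinarith [h3, h4, h5, h6, h7, hβle, sq_nonneg r₀]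
    · dsimp only
      rw [ht']
      linarith
    · intro y hy
      rw [mem_ball] at hy ⊢
      have hxx : dist x' x₀ ≤ R := by
        rw [hx', dist_eq_norm, add_sub_cancel_left, norm_smul, Real.norm_of_nonneg hRpos.le]
        exact mul_le_of_le_one_right hRpos.le hz'n.le
      calc dist y x₀ ≤ dist y x' + dist x' x₀ := dist_triangle _ _ _
        _ < ρ' + R := add_lt_add_of_lt_of_le hy hxx
        _ ≤ κ * R + κ * R := add_le_add hρ'le hRκR
        _ ≤ r₀ := by linarith
  -- the cubic integral of the zoom over `Q(z', r)`
  have hI : ∫⁻ w in parabolicCylinder r z', ‖(α • stPull β R T x₀ u) w.1 w.2‖ₑ ^ (3 : ℕ) =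
      ‖α‖ₑ ^ 3 * ENNReal.ofReal (β * R ^ 3)⁻¹ * ∫⁻ w in S, ‖u w.1 w.2‖ₑ ^ (3 : ℕ) := by
    rw [hpre, setLIntegral_enorm_pow_stRescale hβpos hRpos T x₀ α u S 3,
      finrank_euclideanSpace_fin]
  have hρ'0 : ENNReal.ofReal ρ' ^ 2 ≠ 0 := pow_ne_zero _ (ENNReal.ofReal_pos.2 hρ'pos).ne'
  have hρ'T : ENNReal.ofReal ρ' ^ 2 ≠ ⊤ := ENNReal.pow_ne_top ENNReal.ofReal_ne_top
  have hI2 : ∫⁻ w in S, ‖u w.1 w.2‖ₑ ^ (3 : ℕ) ≤ ENNReal.ofReal (ρ' ^ 2) * (M : ℝ≥0∞) := by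
    calc ∫⁻ w in S, ‖u w.1 w.2‖ₑ ^ (3 : ℕ)
        ≤ ∫⁻ w in parabolicCylinder ρ' ((t', x') : ℝ × (EuclideanSpace ℝ (Fin 3))),
            ‖u w.1 w.2‖ₑ ^ (3 : ℕ) := lintegral_mono_set hSsub
      _ = ENNReal.ofReal ρ' ^ 2 * cknC ρ' ((t', x') : ℝ × (EuclideanSpace ℝ (Fin 3))) u := by
          rw [cknC, ← mul_assoc, ENNReal.mul_inv_cancel hρ'0 hρ'T, one_mul]
      _ ≤ ENNReal.ofReal ρ' ^ 2 * (M : ℝ≥0∞) := mul_le_mul' le_rfl (hC ρ' (t', x') hρ'pos hQ'sub)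
      _ = ENNReal.ofReal (ρ' ^ 2) * (M : ℝ≥0∞) := by rw [ENNReal.ofReal_pow hρ'pos.le]
  -- assemble: the factor `r²` cancels
  have hr0 : ENNReal.ofReal r ^ 2 ≠ 0 := pow_ne_zero _ (ENNReal.ofReal_pos.2 hr).ne'
  have hrT : ENNReal.ofReal r ^ 2 ≠ ⊤ := ENNReal.pow_ne_top ENNReal.ofReal_ne_top
  have e1 : ENNReal.ofReal (ρ' ^ 2) = ENNReal.ofReal ((κ * R) ^ 2) * ENNReal.ofReal r ^ 2 := by
    rw [hρ', hρ, show (κ * (R * r)) ^ 2 = (κ * R) ^ 2 * r ^ 2 by ring,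
      ENNReal.ofReal_mul (sq_nonneg _), ENNReal.ofReal_pow hr.le]
  rw [cknC, hI]
  calc (ENNReal.ofReal r ^ 2)⁻¹ * (‖α‖ₑ ^ 3 * ENNReal.ofReal (β * R ^ 3)⁻¹ *
        ∫⁻ w in S, ‖u w.1 w.2‖ₑ ^ (3 : ℕ))
      ≤ (ENNReal.ofReal r ^ 2)⁻¹ * (‖α‖ₑ ^ 3 * ENNReal.ofReal (β * R ^ 3)⁻¹ *
          (ENNReal.ofReal (ρ' ^ 2) * (M : ℝ≥0∞))) := by gcongr
    _ = ‖α‖ₑ ^ 3 * ENNReal.ofReal (β * R ^ 3)⁻¹ * (ENNReal.ofReal ((κ * R) ^ 2) * (M : ℝ≥0∞)) *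
          ((ENNReal.ofReal r ^ 2)⁻¹ * ENNReal.ofReal r ^ 2) := by
        rw [e1]
        generalize ‖α‖ₑ ^ 3 = A₁
        generalize ENNReal.ofReal (β * R ^ 3)⁻¹ = A₂
        generalize ENNReal.ofReal ((κ * R) ^ 2) = A₃
        generalize ENNReal.ofReal r = A₄
        ring
    _ = _ := by rw [ENNReal.inv_mul_cancel hr0 hrT, mul_one]

/-! ### The zoom about a final-time point is locally Type I (cubic case) -/

/-- **The viscosity-normalising zoom about a final-time point is locally Type I, under a local
bound of the scaled cubic quantity.** For a classical solution on `[0, T)` (viscosity `ν > 0`),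
Leray–Hopf on `[0, T]`, a point `x₀` and a radius `r₀ > 0` with `C(Q(z, r)) ≤ M` for every parabolic
sub-ball `Q(z, r) ⊆ Q((T, x₀), r₀)`, there are `R, α, β > 0` (`β ≤ T`) such that the pair
`v = α u ∘ Φ`, `π = α² q ∘ Φ` is a suitable weak solution of the unit-viscosity system in `Q(0, 1)`
with the zoomed classical gradient as weak gradient and `𝐈(Q(0, 1/2)) < ⊤`: the scaled cubic
quantity of `v` is bounded on all parabolic sub-balls of `Q(0,1)` (each is the preimage of an
anisotropic physical cylinder contained in a standard sub-ball of `Q((T, x₀), r₀)` of `κ = max(1, 1/ν)`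
times the radius), and the tree's `albrittonBarker2019_lemma_2_6_holds` (`C`-case) bounds `A, D, E`.
[cite: AlbrittonBarker2019, Lemma 2.6 and Def. 2.1] -/
theorem exists_zoom_typeIBound_lt_top_of_cknC (hν : 0 < ν) (hT : 0 < T)
    (hsol : IsClassicalNSSolutionOn (Ico 0 T) ν 0 u p) (hLH : IsLerayHopfOn T ν 0 (u 0) u)
    (x₀ : (EuclideanSpace ℝ (Fin 3))) {r₀ : ℝ} (hr₀ : 0 < r₀) {M : ℝ≥0}
    (hC : ∀ (r : ℝ) (z : ℝ × (EuclideanSpace ℝ (Fin 3))), 0 < r →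
      parabolicCylinder r z ⊆ parabolicCylinder r₀ ((T, x₀) : ℝ × (EuclideanSpace ℝ (Fin 3))) →
        cknC r z u ≤ M) :
    ∃ R α β : ℝ, 0 < R ∧ 0 < α ∧ 0 < β ∧ β ≤ T ∧
      IsSuitableWeakSolutionInBall 1 0 (α • stPull β R T x₀ u)
        (α ^ 2 • stPull β R T x₀ fun t x => p t x - (p t 0 - normalisedPressure (u t) 0)) ∧
      HasWeakSpatialGradientOn (parabolicCylinderOpens 1 (0 : ℝ × (EuclideanSpace ℝ (Fin 3)))) (α • stPull β R T x₀ u)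
        ((α * R) • stPull β R T x₀ fun t x => fderiv ℝ (u t) x) ∧
      typeIBound (parabolicCylinder (1 / 2) (0 : ℝ × (EuclideanSpace ℝ (Fin 3)))) (α • stPull β R T x₀ u)
        (α ^ 2 • stPull β R T x₀ fun t x => p t x - (p t 0 - normalisedPressure (u t) 0))
        ((α * R) • stPull β R T x₀ fun t x => fderiv ℝ (u t) x) < ⊤ := by
  -- the anisotropy factor `κ = max(1, 1/ν)`: `κ ≥ 1`, `κ² ≥ 1/ν`
  set κ : ℝ := max 1 ν⁻¹ with hκdef
  have hκ1 : 1 ≤ κ := le_max_left _ _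
  have hκν : ν⁻¹ ≤ κ := le_max_right _ _
  have hκpos : 0 < κ := lt_of_lt_of_le one_pos hκ1
  have hκsq : ν⁻¹ ≤ κ ^ 2 := by nlinarith [inv_pos.2 hν]
  -- scales: `R² / ν ≤ T`, `2 κ R ≤ r₀`
  set R : ℝ := min (Real.sqrt (ν * T)) (r₀ / (2 * κ)) with hR
  have hRpos : 0 < R := lt_min (Real.sqrt_pos.2 (by positivity)) (by positivity)
  have hRκ : κ * R ≤ r₀ / 2 := by
    have h1 : R ≤ r₀ / (2 * κ) := min_le_right _ _
    calc κ * R ≤ κ * (r₀ / (2 * κ)) := mul_le_mul_of_nonneg_left h1 hκpos.le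
      _ = r₀ / 2 := by field_simp
  set α : ℝ := R / ν with hα
  set β : ℝ := R ^ 2 / ν with hβdef
  have hαpos : 0 < α := by positivity
  have hβpos : 0 < β := by positivity
  have hβeq : β = α * R := by rw [hβdef, hα]; field_simp
  have hβT : β ≤ T := by
    have h1 : R ≤ Real.sqrt (ν * T) := min_le_left _ _
    have h2 : R ^ 2 ≤ ν * T := by
      have := pow_le_pow_left₀ hRpos.le h1 2
      rwa [Real.sq_sqrt (by positivity)] at this
    rw [hβdef, div_le_iff₀ hν]; linarith
  refine ⟨R, α, β, hRpos, hαpos, hβpos, hβT, ?_⟩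
  -- the gauged pressure
  set q : ℝ → (EuclideanSpace ℝ (Fin 3)) → ℝ := fun t x => p t x - (p t 0 - normalisedPressure (u t) 0) with hq
  -- the `ν`-cylinder `(T - β, T) × B(x₀, R)` inside the slab, and its preimage `Q(0,1)`
  set PO : TopologicalSpace.Opens (ℝ × (EuclideanSpace ℝ (Fin 3))) :=
    ⟨Ioo (T - β) T ×ˢ ball x₀ R, isOpen_Ioo.prod isOpen_ball⟩ with hPO
  have hPOslab : (PO : Set (ℝ × (EuclideanSpace ℝ (Fin 3)))) ⊆ Ioo 0 T ×ˢ (univ : Set (EuclideanSpace ℝ (Fin 3))) := by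
    rintro ⟨t, x⟩ ⟨ht, -⟩
    exact ⟨⟨by linarith [ht.1], ht.2⟩, mem_univ _⟩
  have hpre1 : stPreimage β R T x₀ PO = parabolicCylinderOpens 1 (0 : ℝ × (EuclideanSpace ℝ (Fin 3))) := by
    apply TopologicalSpace.Opens.ext
    rw [coe_stPreimage]
    have h := stAffine_preimage_cylinder_eq_parabolicCylinder hν hRpos T x₀ R
    rw [div_self hRpos.ne'] at h
    exact h
  -- suitability of the zoom on `Q(0,1)` with unit viscosity
  have hsuit1 : IsSuitableWeakSolutionOn (parabolicCylinderOpens 1 (0 : ℝ × (EuclideanSpace ℝ (Fin 3)))) 1 0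
      (α • stPull β R T x₀ u) (α ^ 2 • stPull β R T x₀ q) := by
    have h0 := (SereginSverak2002.isSuitableWeakSolutionOn_gauge_of_classical hν hT hsol hLH PO
      hPOslab).stRescale hαpos hRpos hβeq T x₀
    have hvisc : α * ν / R = 1 := by rw [hα, div_mul_cancel₀ R hν.ne', div_self hRpos.ne']
    have hforce : ((α ^ 2 * R) • stPull β R T x₀ (0 : ℝ → (EuclideanSpace ℝ (Fin 3)) → (EuclideanSpace ℝ (Fin 3)))) = 0 := by
      funext s y; simp [stPull]
    rw [hvisc, hforce, hpre1] at h0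
    exact h0
  -- the zoomed classical gradient
  have hGu : HasWeakSpatialGradientOn PO u fun t x => fderiv ℝ (u t) x :=
    hasWeakSpatialGradientOn_of_contDiffOn isOpen_Ioo hPOslab
      ((SereginSverak2002.classical_Ioo hsol).smooth_velocity.of_le (by norm_cast))
  have hGv : HasWeakSpatialGradientOn (parabolicCylinderOpens 1 (0 : ℝ × (EuclideanSpace ℝ (Fin 3))))
      (α • stPull β R T x₀ u) ((α * R) • stPull β R T x₀ fun t x => fderiv ℝ (u t) x) := by
    rw [← hpre1]
    exact hGu.stRescale α hβpos hRpos T x₀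
  -- the class `IsSuitableWeakSolutionInBall 1 0`
  have hball : IsSuitableWeakSolutionInBall 1 0 (α • stPull β R T x₀ u)
      (α ^ 2 • stPull β R T x₀ q) := by
    refine ⟨hsuit1, ?_, ⟨_, hGv, ?_⟩, ?_⟩
    · -- energy class
      set CE : ENNReal := ENNReal.ofReal (2 * VectorCalculus.kineticEnergy (u 0)) with hCE
      have hphys : ∀ᵐ t ∂(volume.restrict (Ioo (T + β * (-1)) (T + β * 0))),
          ∫⁻ x in ball x₀ R, ‖u t x‖ₑ ^ 2 ≤ CE := by
        refine (ae_restrict_mem measurableSet_Ioo).mono fun t ht => ?_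
        have htI : t ∈ Icc 0 T :=
          ⟨by nlinarith [ht.1], by have := ht.2; simp at this; exact this.le⟩
        exact (setLIntegral_le_lintegral _ _).trans (SereginSverak2002.eEnergy_le hν.le hLH htI)
      have h2 := ae_sliced_setLIntegral_ball_stRescale hβpos hRpos T x₀ x₀ R (-1) 0
        (fun t x => ‖u t x‖ₑ ^ 2) hphys
      rw [finrank_euclideanSpace_fin, sub_self, smul_zero, div_self hRpos.ne'] at h2
      set C₁ : ENNReal := ‖α‖ₑ ^ 2 * (ENNReal.ofReal (R ^ 3)⁻¹ * CE) with hC₁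
      have hC₁top : C₁ ≠ ⊤ :=
        ENNReal.mul_ne_top (by simp) (ENNReal.mul_ne_top ENNReal.ofReal_ne_top ENNReal.ofReal_ne_top)
      refine ⟨C₁.toNNReal, ?_⟩
      rw [ENNReal.coe_toNNReal hC₁top]
      have hset : Ioo ((0 : ℝ × (EuclideanSpace ℝ (Fin 3))).1 - 1 ^ 2) (0 : ℝ × (EuclideanSpace ℝ (Fin 3))).1 = Ioo (-1 : ℝ) 0 := by simp
      rw [hset]
      filter_upwards [h2] with s hs
      have e : ∀ y : (EuclideanSpace ℝ (Fin 3)), ‖(α • stPull β R T x₀ u) s y‖ₑ ^ 2 =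
          ‖α‖ₑ ^ 2 * ‖u (T + β * s) (x₀ + R • y)‖ₑ ^ 2 := by
        intro y
        rw [smul_stPull_apply, enorm_smul, mul_pow]
      simp only [e]
      rw [lintegral_const_mul' _ _ (by simp)]
      exact mul_le_mul' le_rfl hs
    · -- `∫_{Q(0,1)} |∇v|² < ⊤`
      have hpre : parabolicCylinder 1 (0 : ℝ × (EuclideanSpace ℝ (Fin 3))) =
          stAffine β R T x₀ ⁻¹' (Ioo (T - (R * 1) ^ 2 / ν) T ×ˢ ball x₀ (R * 1)) := by
        rw [hβdef, stAffine_preimage_cylinder_eq_parabolicCylinder hν hRpos T x₀ (R * 1),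
          mul_div_cancel_left₀ (1 : ℝ) hRpos.ne']
        rfl
      rw [hpre, setLIntegral_frobeniusNormSq_stRescale hβpos hRpos T x₀ (α * R),
        finrank_euclideanSpace_fin]
      refine ENNReal.mul_lt_top (ENNReal.mul_lt_top ENNReal.ofReal_lt_top ENNReal.ofReal_lt_top) ?_
      refine lt_of_le_of_lt (lintegral_mono_set ?_)
        (SereginSverak2002.lintegral_slab_frobeniusNormSq_fderiv_lt_top' hsol hLH)
      rw [mul_one]
      rintro ⟨t, x⟩ ⟨ht, -⟩
      refine ⟨⟨?_, ht.2⟩, mem_univ _⟩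
      have : R ^ 2 / ν = β := rfl
      linarith [ht.1]
    · -- `π ∈ L^{3/2}(Q(0,1))`
      refine ⟨hsuit1.distributional.2.2.1.aestronglyMeasurable, ?_⟩
      have h32 : ((3 : ENNReal) / 2).toReal = 3 / 2 := by rw [ENNReal.toReal_div]; norm_num
      have h32top : (3 : ENNReal) / 2 ≠ ⊤ := (ENNReal.div_lt_top (by simp) (by simp)).ne
      rw [eLpNorm_eq_lintegral_rpow_enorm_toReal (by norm_num) h32top, h32]
      refine ENNReal.rpow_lt_top_of_nonneg (by positivity) (ne_of_lt ?_)
      have hQ1 : parabolicCylinder 1 (0 : ℝ × (EuclideanSpace ℝ (Fin 3))) = stAffine β R T x₀ ⁻¹' (PO : Set (ℝ × (EuclideanSpace ℝ (Fin 3)))) := by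
        rw [← coe_stPreimage, hpre1]; rfl
      rw [hQ1]
      show ∫⁻ z in stAffine β R T x₀ ⁻¹' (PO : Set (ℝ × (EuclideanSpace ℝ (Fin 3)))),
          ‖(α ^ 2 • stPull β R T x₀ q) z.1 z.2‖ₑ ^ (3 / 2 : ℝ) < ⊤
      rw [setLIntegral_enorm_rpow_stRescale hβpos hRpos T x₀ (α ^ 2) q _ (by norm_num)]
      refine ENNReal.mul_lt_top (ENNReal.mul_lt_top
        (ENNReal.rpow_lt_top_of_nonneg (by norm_num) enorm_ne_top) ENNReal.ofReal_lt_top) ?_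
      exact lt_of_le_of_lt (lintegral_mono_set hPOslab)
        (SereginSverak2002.lintegral_slab_gauged_pressure_lt_top hν hT hsol hLH)
  -- ### the scaled cubic quantity `C` on every parabolic sub-ball of `Q(0,1)`
  have hβle : β ≤ κ ^ 2 * R ^ 2 := by
    rw [hβdef, div_eq_mul_inv, mul_comm]
    exact mul_le_mul_of_nonneg_right hκsq (sq_nonneg _)
  set B : ℝ≥0∞ := ‖α‖ₑ ^ 3 * ENNReal.ofReal (β * R ^ 3)⁻¹ *
    (ENNReal.ofReal ((κ * R) ^ 2) * (M : ℝ≥0∞)) with hBdef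
  have hBtop : B < ⊤ := ENNReal.mul_lt_top (ENNReal.mul_lt_top (by simp) ENNReal.ofReal_lt_top)
    (ENNReal.mul_lt_top ENNReal.ofReal_lt_top ENNReal.coe_lt_top)
  have hCv : ∀ (r : ℝ) (z' : ℝ × (EuclideanSpace ℝ (Fin 3))), 0 < r →
      parabolicCylinder r z' ⊆ parabolicCylinder 1 (0 : ℝ × (EuclideanSpace ℝ (Fin 3))) →
      cknC r z' (α • stPull β R T x₀ u) ≤ B := fun r z' hr hz' =>
    cknC_zoom_le x₀ hRpos hβpos hκ1 hβle hRκ u hC hr hz'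
  have hCsup : (⨆ (r : ℝ) (_ : 0 < r) (z' : ℝ × (EuclideanSpace ℝ (Fin 3)))
      (_ : parabolicCylinder r z' ⊆ parabolicCylinder 1 (0 : ℝ × (EuclideanSpace ℝ (Fin 3)))),
        cknC r z' (α • stPull β R T x₀ u)) < ⊤ := by
    refine lt_of_le_of_lt ?_ hBtop
    exact iSup_le fun r => iSup_le fun hr => iSup_le fun z' => iSup_le fun hz' => hCv r z' hr hz'
  exact ⟨hball, hGv, albrittonBarker2019_lemma_2_6_holds 0 _ _ hball _ hGv (Or.inr (Or.inl hCsup))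
    (1 / 2) (by norm_num) (by norm_num)⟩

end LocalTypeIExtraction

open LocalTypeIExtraction in
/-- **Item stmt-NavierStokesRegularity-11301** (`MarginalTypeI.LocalTypeIExtraction`): a smooth,
divergence-free, rapidly decaying datum without global Kato solution, all of whose Kato solutions
have a locally bounded scaled cubic quantity at the final time, yields a local Type-I singular point
of a suitable weak solution (the unit-viscosity zoom of the maximal classical development about a
final-time point where it is not backward bounded).
[cite: AlbrittonBarker2019, Thm. 1.1, Def. 2.1 and Lemma 2.6; LemarieRieusset2016, Thm. 15.1] -/
theorem marginalTypeI_localTypeIExtraction_proof :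
    Summit.NavierStokesRegularity.NavierStokesRegularity.Theses.MarginalTypeI.LocalTypeIExtraction := by
  unfold Summit.NavierStokesRegularity.NavierStokesRegularity.Theses.MarginalTypeI.LocalTypeIExtraction
  intro ν hν u₀ hsm hdiv hdec hng hext
  have hdiv' : VectorCalculus.IsDivFree u₀ := hdiv
  -- finite Kato maximal time, maximal classical development
  have hlt : katoMaximalTime ν u₀ < ⊤ := lt_top_iff_ne_top.2 fun h =>
    hng ((katoMaximalTime_eq_top_iff kato_unique_holds hν).1 h)
  obtain ⟨T, hT, -, u, p, hu0, hmax, hLH⟩ :=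
    CertifiedBlowupAxisymBlowup.CompactAmplification.exists_isMaximalSmoothSolution_of_katoMaximalTime_lt_top
      hν hsm hdiv' hdec hlt
  have hLH' : IsLerayHopfOn T ν 0 (u 0) u := by rw [hu0]; exact hLH
  have hdec' : HasRapidSpatialDecay (u 0) := by rw [hu0]; exact hdec
  -- a final-time point where `u` is not backward bounded
  obtain ⟨x₀, hx₀⟩ := TypeIBridge.exists_not_isBackwardBoundedAt hν hT hmax hLH'
  -- the hypothesis, applied to this Kato solution at `x₀`
  have hkato : IsKatoSolutionOn T ν u₀ u := by
    have h := isKatoSolutionOn_of_classical hν hT hmax.1 hLH' hdec'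
    rwa [hu0] at h
  obtain ⟨r₀, hr₀, hsup⟩ := hext T u hT hkato x₀
  obtain ⟨M, hM⟩ := exists_bound_of_iSup_lt_top (F := fun r z => cknC r z u) hsup
  -- the zoom
  obtain ⟨R, α, β, hR, hα, hβ, hβT, hball, hGv, htypeI⟩ :=
    exists_zoom_typeIBound_lt_top_of_cknC hν hT hmax.1 hLH' x₀ hr₀ (M := M)
      (fun r z hr hz => hM r z hr hz)
  have hsing : IsBackwardSingularPoint (α • stPull β R T x₀ u) (0 : ℝ × EuclideanSpace ℝ (Fin 3)) := by
    intro r hr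
    by_contra hfin
    have hfin' : eLpNorm (uncurry (α • stPull β R T x₀ u)) ⊤
        (volume.restrict (parabolicCylinder (min r 1) (0 : ℝ × EuclideanSpace ℝ (Fin 3)))) < ⊤ := by
      refine lt_of_le_of_lt (eLpNorm_mono_measure _ (Measure.restrict_mono ?_ le_rfl))
        (lt_top_iff_ne_top.2 hfin)
      exact SuitableCompactness.parabolicCylinder_zero_mono (le_min hr.le zero_le_one) (min_le_left _ _)
    exact hx₀ (SereginSverak2002.isBackwardBoundedAt_of_zoom hmax.1 x₀ hR hα hβ hβT
      (lt_min hr one_pos) (min_le_right _ _) hfin')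
  refine ⟨1 / 2, 0, α • stPull β R T x₀ u,
    α ^ 2 • stPull β R T x₀ (fun t x => p t x - (p t 0 - normalisedPressure (u t) 0)),
    by norm_num, ?_, hsing, _,
    hGv.mono (SuitableCompactness.parabolicCylinderOpens_zero_mono (by norm_num) (by norm_num)),
    htypeI⟩
  exact SuitableCompactness.isSuitableWeakSolutionInBall_of_le_radius hball (by norm_num) (by norm_num)

end Summit.NavierStokesRegularity.NavierStokesRegularity.Theorems

end
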